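import Summits.BirchSwinnertonDyer.Rank1Residual.X2.NonsplitControlAtoms
import Summits.BirchSwinnertonDyer.Rank1Residual.X2.NonsplitBaseSelmerCount
import Summits.BirchSwinnertonDyer.Rank1Residual.X2.Cells
import Summits.BirchSwinnertonDyer.Rank1Residual.X11b.RouteR1LocalKernelRecord
import HarnessLib

/-!
# Class X2 at a NON-SPLIT multiplicative prime: the anticyclotomic CONTROL THEOREM (Cas18 Thm. 2.3 /
# JSW17 Thm. 3.3.1 shape) on X2c ∩ {non-split} data, as a THEOREM from the cited cohomological facts
# (cell `bsd-eis`, seat `bsd-eis-cgshw`; TARGET §6.2 CTL port, brick 4 = assembly)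

HONEST FRAMING (cell `bsd-eis`): theorems only; nothing booked; X2 stays CONSTRUCTION-SHAPED. The
X11b seats proved `X11b.ControlOnTreeAt p κ 𝔭 γ ι P` ("`ord_p f_ac(0) = ord_p #Ш(E/K)[p^∞] + 2((ord_p
log_ω P − 1) − ord_p [E(K):ℤP]) + ord_p ∏_{w∣N⁺} c_w`" for a generator `f_ac` of the characteristic
ideal of the constructed `X_ac(E[p^∞])`) at every route-R1 datum from four atoms (P6), (P9), (L10),
(P11) and discharged the atoms from cited cohomological facts — under the erratum's `Irr ∧ Ram` and
(iv). Bricks 1–3 of this port (`X2/NonsplitNoTorsion.lean`, `X2/NonsplitBaseSelmerCount.lean`,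
`X2/NonsplitControlAtoms.lean`) re-derived (P6), (P9), (L10) and the bijectivity of the relaxed control
map on X2 ∩ {non-split} data, where every torsion input is FREE (`E(ℚ_p)[p] = 0` at an odd non-split
multiplicative prime). This file assembles them exactly as `X11b.controlOnTreeAt_of_atoms` does and
states the control theorem at an X2c ∩ {non-split} datum with a CGLS field: `CellC W p`, `¬Split`,
`K` imaginary quadratic with `p` split and `L(E^{(d_K)},1) ≠ 0`, a non-torsion `P ∈ E(K)`, an
anticyclotomic `κ` with topological generator `γ`, a degree-one `𝔭 ∣ p`. Inputs: GZK over `ℚ`,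
modularity, and the FIVE cited facts of the X11b chain (Poitou–Tate for Selmer structures, Poitou–Tate
for `Ш`, local Euler–Poincaré, `cd_p ≤ 2`, Brink's decomposition law). This is the `ControlAt` link of
`X2/RankOneLinks.lean` on the two NON-SPLIT O9 sub-cells (memo `cgshw-MEMO-2.md` Addendum A): no
Keller–Yin App. B, no irreducibility. CONDITIONAL on the cited facts; nothing else.

References: [Castella2018] Thm. 2.3; [JetchevSkinnerWan2017] Thm. 3.3.1, §3.3; [GreenbergLNM1716]
§3–4; [Brink2007] Thm. 2 / Cor. 1; [MilneADT2006] I.2.8, I.4.10.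
-/

set_option autoImplicit false

noncomputable section

open scoped Classical

open WeierstrassCurve NumberField IsDedekindDomain Field
open Literature.NumberTheory.EllipticCurves Literature.NumberTheory.EllipticCurves.GreenbergSelmer
  Literature.NumberTheory.EllipticCurves.ModularForms
  Literature.NumberTheory.EllipticCurves.Rank1Residual
  Literature.NumberTheory.EllipticCurves.Rank1Residual.Typed
  Literature.NumberTheory.GaloisRepresentations Literature.NumberTheory.GaloisCohomology
  Literature.NumberTheory.Automorphic
  Summit.BirchSwinnertonDyer.Rank1Residual.X11b.AcSelmer
  Summit.BirchSwinnertonDyer.Rank1Residual.X11b.LocBridge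
  Summit.BirchSwinnertonDyer.Rank1Residual.X11b

namespace Summit.BirchSwinnertonDyer.Rank1Residual.X2

variable (W : WeierstrassCurve ℚ) [W.IsElliptic] [W.IsGloballyMinimal] (p : ℕ) [Fact p.Prime]

/-- **(CTL) FROM THE ATOMS at an X2 ∩ {non-split} datum** (X2 twin of `X11b.controlOnTreeAt_of_atoms`,
verbatim with the bijectivity of `s^{Σ(N⁺)}` taken from `controlMap_bijective_nPlus_of_not_split`):
(P6) ∧ (P9) ∧ (L10) ∧ (P11) at every `w ∈ Σ(N⁺)` ⟹ `ControlOnTreeAt p κ 𝔭 γ ι P`.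
[cite: Castella2018, Thm. 2.3 (arXiv:1704.06608 p. 5)]
[cite: JetchevSkinnerWan2017, Thm. 3.3.1 and §3.3.2–3.3.6 (arXiv:1512.06894 pp. 11–14)] -/
theorem controlOnTreeAt_of_atoms_of_not_split (hp3 : 3 ≤ p) (hmult : Mult W p)
    (hns : ¬ W.HasSplitMultiplicativeReductionAtPrime p) {K : Type} [Field K] [NumberField K]
    (hK : IsImaginaryQuadratic K) (hsplit : SplitsIn K p) {κ : ZpExtension K p}
    (hκ : κ.IsAnticyclotomic) (γ : absoluteGaloisGroup K) [hγ : Fact (κ.IsTopGenerator γ)]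
    (𝔭 : HeightOneSpectrum (𝓞 K)) (h𝔭 : ((p : ℕ) : 𝓞 K) ∈ 𝔭.asIdeal)
    (he : 𝔭.asIdeal.ramificationIdx (𝓞 ℚ) = 1) (hf : 𝔭.asIdeal.inertiaDeg (𝓞 ℚ) = 1)
    (ι : K →+* ℚ_[p]) (P : (W.baseChange K).toAffine.Point) (h6 : BaseSelmerCountAt p 𝔭 ι P)
    (h9 : LocSurjAt (W.baseChange K) p 𝔭 (nPlusPlaces_finite (W := W) (p := p) hK.1))
    (h10 : CoinvariantsTrivialAt (W.baseChange K) p κ 𝔭 γ)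
    (h11 : ∀ v ∈ nPlusPlaces W K p, LocalKernelOrderAt (W.baseChange K) p κ v) :
    ControlOnTreeAt p κ 𝔭 γ ι P := by
  have hp : p.Prime := Fact.out
  rw [controlOnTreeAt_iff_card p κ 𝔭 γ ι P]
  obtain ⟨a, ⟨_, hcardK⟩, ha⟩ := h6
  set hfin := nPlusPlaces_finite (W := W) (p := p) (K := K) hK.1 with hfin_def
  have hpN : p ∣ W.conductorNorm ℤ := dvd_conductorNorm_of_mult hmult
  have hSp : ∀ v ∈ nPlusPlaces W K p, ((p : ℕ) : 𝓞 K) ∉ v.asIdeal :=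
    fun v hv ↦ ((mem_nPlusPlaces_iff v).mp hv).1
  have hbij := controlMap_bijective_nPlus_of_not_split W p hp3 hmult hns hK hκ hγ.out 𝔭 h𝔭 he hf
  have hloc : localKerPi (W.baseChange K) p κ hfin ≤ (locSel (W.baseChange K) p 𝔭 hfin).range := by
    rw [AddMonoidHom.range_eq_top.mpr h9]
    exact le_top
  have hcard := natCard_endInvariants_empty_eq_mul_prod (hS := hfin) hSp γ hbij hloc
  have hprod : (∏ v ∈ hfin.toFinset,
      Nat.card (localKer κ.kerSubgroup ((W.baseChange K).geomPrimaryTorsion p) v)) =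
      p ^ ∑ v ∈ hfin.toFinset, padicValNat p
        (((W.baseChange K).baseChange (v.adicCompletion K)).localTamagawaNumber
          (v.adicCompletionIntegers K)) := by
    rw [← Finset.prod_pow_eq_pow_sum]
    refine Finset.prod_congr rfl fun v hv => ?_
    obtain ⟨_, hv'⟩ := h11 v (hfin.mem_toFinset.mp hv)
    exact hv'
  have hcoinv := natCard_endCoinvariants_eq_one_of_surjective _ h10
  refine ⟨a + ∑ v ∈ hfin.toFinset, padicValNat p
      (((W.baseChange K).baseChange (v.adicCompletion K)).localTamagawaNumber
        (v.adicCompletionIntegers K)), ⟨?_, ?_⟩, ?_⟩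
  · refine Nat.finite_of_card_ne_zero ?_
    rw [hcard, hcardK, hprod, ← pow_add]
    exact pow_ne_zero _ hp.ne_zero
  · rw [hcard, hcardK, hprod, hcoinv, mul_one, pow_add]
  · rw [Nat.cast_add, ha, padicValNat_tamagawaProductSplit_eq_above_add_sum W p hK.1 hsplit hpN]
    push_cast
    ring

/-- **THE ANTICYCLOTOMIC CONTROL THEOREM ON X2 ∩ {non-split} DATA (Cas18 Thm. 2.3 / JSW17 Thm. 3.3.1
shape on the tree's constructed `X_ac`), from cited cohomological facts only.** For `W/ℚ` globally
minimal elliptic and `p` an odd NON-SPLIT multiplicative prime (any image of `E[p]`; in particular a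
rank-one X2 pair, `CellC W p`), `ord_{s=1} L(E,s) = 1`, a CGLS field `K` (imaginary quadratic, `p`
split, `L(E^{(d_K)},1) ≠ 0`, so `rank E(K) = 1` and `Ш(E/K)` finite by GZK over `ℚ`), a non-torsion
`P ∈ E(K)`, an anticyclotomic `κ` with topological generator `γ`, and a degree-one `𝔭 ∣ p`:
`ControlOnTreeAt p κ 𝔭 γ (embAt K p 𝔭) P` — i.e. for a generator `f_ac` of `char(X_ac(E[p^∞]))`,
`ord_p f_ac(0) = ord_p #Ш(E/K)[p^∞] + 2((ord_p log_ω P − 1) − ord_p [E(K):ℤP]) + ord_p ∏_{w∣N, w split} c_w`.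
Inputs: (P6) `baseSelmerCountAt_of_rankOne_of_not_split`, (L10) `coinvariantsTrivialAt_of_not_split`,
(P9) `locSurjAt_of_finite_conj_of_not_split` at the conjugate prime, (P11)
`X11b.r1LocalKernelOrderAt_of_anticyclotomicDecomposition` (Brink), assembled by
`controlOnTreeAt_of_atoms_of_not_split`. NO irreducibility, NO Keller–Yin App. B (the torsion terms
vanish: `E(ℚ_p)[p] = 0`). CONDITIONAL on the five cited facts `hPT`, `hPT2`, `hEP`, `hcd`, `hBr` and on
GZK/modularity. [cite: Castella2018, Thm. 2.3 (arXiv:1704.06608 p. 5)]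
[cite: JetchevSkinnerWan2017, Thm. 3.3.1, Prop. 3.2.1, Prop. 3.3.2, Lemma 3.3.3, Prop. 3.3.4 (arXiv:1512.06894 pp. 10–13)]
[cite: Brink2007, Thm. 2 and Cor. 1 (pp. 2134–2136)] -/
theorem controlOnTreeAt_of_not_split_of_rankOne
    (hGZK : rank_eq_analyticRank_of_analyticRank_le_one) (hnf : exists_isNewformOf)
    (hPT : ∀ (K : Type) [Field K] [NumberField K], poitouTate_selmerStructure_duality K)
    (hPT2 : ∀ (K : Type) [Field K] [NumberField K], poitouTate_sha_tateDual K)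
    (hEP : ∀ (K : Type) [Field K] [NumberField K] (v : HeightOneSpectrum (𝓞 K)),
      localEulerPoincareCharacteristic (v.adicCompletion K))
    (hcd : fieldCdLE_two_of_numberField)
    (hBr : ∀ (K : Type) [Field K] [NumberField K] (p : ℕ) [Fact p.Prime],
      ZpExtension.decomp_not_le_kerSubgroup_of_isAnticyclotomic K p)
    (hp2 : p ≠ 2) (hmult : Mult W p) (hns : ¬ W.HasSplitMultiplicativeReductionAtPrime p)
    (hr : W.analyticRank = 1) {K : Type} [Field K] [NumberField K] (hK : IsImaginaryQuadratic K)
    (hsplit : SplitsIn K p) (hLt : (W.quadraticTwist (NumberField.discr K : ℚ)).entireLFunction 1 ≠ 0)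
    (P : (W.baseChange K).toAffine.Point) (hPinf : ¬ IsOfFinAddOrder P)
    (κ : ZpExtension K p) (hκ : κ.IsAnticyclotomic) (γ : absoluteGaloisGroup K)
    [hγ : Fact (κ.IsTopGenerator γ)] (𝔭 : HeightOneSpectrum (𝓞 K))
    (h𝔭 : ((p : ℕ) : 𝓞 K) ∈ 𝔭.asIdeal) (he : 𝔭.asIdeal.ramificationIdx (𝓞 ℚ) = 1)
    (hf : 𝔭.asIdeal.inertiaDeg (𝓞 ℚ) = 1) :
    ControlOnTreeAt p κ 𝔭 γ (embAt K p 𝔭 h𝔭 he hf) P := by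
  have hp : p.Prime := Fact.out
  have hp3 : 3 ≤ p := by
    rcases hp.eq_two_or_odd with h | h
    · exact absurd h hp2
    · have := hp.two_le
      omega
  obtain ⟨hrank, hSha⟩ := mordellWeilRank_eq_one_and_shaFinite_of_twist W hGZK hnf hr hK.1 hLt
  -- (P6) at every degree-one prime above `p`
  have h6 : ∀ (𝔮 : HeightOneSpectrum (𝓞 K)) (h𝔮 : ((p : ℕ) : 𝓞 K) ∈ 𝔮.asIdeal)
      (he' : 𝔮.asIdeal.ramificationIdx (𝓞 ℚ) = 1) (hf' : 𝔮.asIdeal.inertiaDeg (𝓞 ℚ) = 1),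
      BaseSelmerCountAt p 𝔮 (embAt K p 𝔮 h𝔮 he' hf') P := fun 𝔮 h𝔮 he' hf' ↦
    baseSelmerCountAt_of_rankOne_of_not_split W p K (hPT K) (hEP K) hp3 hmult hns hK hsplit hrank
      hSha P hPinf 𝔮 h𝔮 he' hf'
  have hfin : ∀ v : HeightOneSpectrum (𝓞 K), ((p : ℕ) : 𝓞 K) ∈ v.asIdeal →
      Finite (selmerAcBase (W.baseChange K) p v ∅) := fun v hv ↦ by
    obtain ⟨he', hf'⟩ := degreeOne_of_splitsIn hK.1 hsplit hv
    obtain ⟨a, ⟨hfinv, -⟩, -⟩ := h6 v hv he' hf'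
    exact hfinv
  -- (L10)
  have h10 : CoinvariantsTrivialAt (W.baseChange K) p κ 𝔭 γ :=
    coinvariantsTrivialAt_of_not_split W p hp3 hmult hns (hPT K) (hPT2 K) (hEP K) hcd hK hsplit κ
      hγ.out h𝔭 he hf hfin
  -- (P9) from finiteness at the conjugate prime
  obtain ⟨σ, 𝔮, -, hne, h𝔮, -⟩ :=
    LocalIndexTransport.exists_conj_prime_of_splitsIn K p hK.1 hsplit h𝔭
  have h9 : LocSurjAt (W.baseChange K) p 𝔭 (nPlusPlaces_finite (W := W) (p := p) hK.1) :=
    locSurjAt_of_finite_conj_of_not_split W p hp3 hmult hns (hPT K) (hEP K) hK κ h𝔭 he hf h𝔮 hne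
      (hfin 𝔮 h𝔮)
  -- (P11) from Brink's decomposition law, and the assembly
  exact controlOnTreeAt_of_atoms_of_not_split W p hp3 hmult hns hK hsplit hκ γ 𝔭 h𝔭 he hf
    (embAt K p 𝔭 h𝔭 he hf) P (h6 𝔭 h𝔭 he hf) h9 h10
    (r1LocalKernelOrderAt_of_anticyclotomicDecomposition W p hBr hp2 K hK κ hκ)

/-- **The same at an X2c pair with a CGLS field in the tree's `SatisfiesHeegnerHypothesis` currency**
(`CellC W p`: `r_an = 1`, `p ≠ 2`, `E[p]` reducible, `p ‖ N`; `SatisfiesHeegnerHypothesis p K` = `p`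
split): the `ControlAt` input of the O9 rank-one chain (`X2/RankOneLinks.lean`) on the sub-cells
`CellCNonsplitGV`, `CellCNonsplitNotGV`, as a theorem. [cite: Castella2018, Thm. 2.3 (arXiv:1704.06608 p. 5)]
[cite: JetchevSkinnerWan2017, Thm. 3.3.1 (arXiv:1512.06894 p. 11)] -/
theorem controlOnTreeAt_of_cellC_of_not_split
    (hGZK : rank_eq_analyticRank_of_analyticRank_le_one) (hnf : exists_isNewformOf)
    (hPT : ∀ (K : Type) [Field K] [NumberField K], poitouTate_selmerStructure_duality K)
    (hPT2 : ∀ (K : Type) [Field K] [NumberField K], poitouTate_sha_tateDual K)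
    (hEP : ∀ (K : Type) [Field K] [NumberField K] (v : HeightOneSpectrum (𝓞 K)),
      localEulerPoincareCharacteristic (v.adicCompletion K))
    (hcd : fieldCdLE_two_of_numberField)
    (hBr : ∀ (K : Type) [Field K] [NumberField K] (p : ℕ) [Fact p.Prime],
      ZpExtension.decomp_not_le_kerSubgroup_of_isAnticyclotomic K p)
    (hc : CellC W p) (hns : ¬ W.HasSplitMultiplicativeReductionAtPrime p)
    {K : Type} [Field K] [NumberField K] (hK : IsImaginaryQuadratic K)
    (hHp : SatisfiesHeegnerHypothesis p K)
    (hLt : (W.quadraticTwist (NumberField.discr K : ℚ)).entireLFunction 1 ≠ 0)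
    (P : (W.baseChange K).toAffine.Point) (hPinf : ¬ IsOfFinAddOrder P)
    (κ : ZpExtension K p) (hκ : κ.IsAnticyclotomic) (γ : absoluteGaloisGroup K)
    [Fact (κ.IsTopGenerator γ)] (𝔭 : HeightOneSpectrum (𝓞 K))
    (h𝔭 : ((p : ℕ) : 𝓞 K) ∈ 𝔭.asIdeal) (he : 𝔭.asIdeal.ramificationIdx (𝓞 ℚ) = 1)
    (hf : 𝔭.asIdeal.inertiaDeg (𝓞 ℚ) = 1) :
    ControlOnTreeAt p κ 𝔭 γ (embAt K p 𝔭 h𝔭 he hf) P :=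
  controlOnTreeAt_of_not_split_of_rankOne W p hGZK hnf hPT hPT2 hEP hcd hBr hc.2.1 hc.2.2.2 hns hc.1 hK
    (hHp p Fact.out dvd_rfl) hLt P hPinf κ hκ γ 𝔭 h𝔭 he hf

end Summit.BirchSwinnertonDyer.Rank1Residual.X2

end
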